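import Summits.Ventures.LatticeQCDFlow.Exactness.ReversibleTauIntFloor
import HarnessLib

/-!
# The `τ_int` floor `(1 + ρ(1))/(2(1 − ρ(1)))` for row 2's HMC sampler (any involutive integrator)

HONEST FRAMING: exact (Metropolis-corrected) sampling algorithms for lattice gauge theory;
figures of merit are autocorrelation/cost numbers at stated couplings and volumes; no
continuum-physics claim.  (SCALAR calibration rung S0-A: not a gauge result.)

Venture `LatticeQCDFlow` (cell pub-lqcd), topic `Exactness`; FANOUT row 2 (`s0-phi4`, HMC arm).
NEW WORK of the cell: the abstract floor of `Exactness/ReversibleTauIntFloor.lean`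
(`reversible_tauInt_ge`) instantiated for the HMC-type update `hmcOpOf J λ Ψ` of
`Exactness/Phi4HMCExact.lean` (ANY measurable Lebesgue-preserving involution `Ψ` of phase space)
and for the engine's qpq leapfrog `hmcOpPhi4 J λ δ N`; (symm) is row 2's
`hmc_reversible_of_involutive`, exactness `hmc_exact_of_involutive` feeds (contr).  Nothing is
cited as a fact.

## What is proved

* `momentumWeight_pos`, `hmcOpOf_integrand_bdd`, `integrable_hmcOpOf_integrand`,
  **`hmcOpOf_bdd`** (measurable, `|K_Ψ f| ≤ B`), **`hmcOpOf_add_mul`** (linear),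
  **`hmcOpOf_sq_le`** (pointwise Jensen `(K_Ψ f)² ≤ K_Ψ(f²)`: Cauchy–Schwarz against the Gaussian
  momentum law + convexity under accept/reject), **`hmcOpOf_contraction`**
  (`∫ (K_Ψ f)² e^{−S} ≤ ∫ f² e^{−S}`);
* **`hmc_tauInt_ge_of_involutive`** — every `λ > 0`, real `J`, involution `Ψ`, bounded measurable
  `f` with `g = f − ⟨f⟩`: summable autocorrelations with `ρ(1) < 1` ⇒
  `τ_int ≥ (1 + ρ(1))/(2(1 − ρ(1)))`; **`hmc_tauInt_ge`** — the same for `hmcOpPhi4 J λ δ N`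
  (every step size, every trajectory length).

Reading for S0-A (no numerics implied): for the HMC arm a measured lag-one autocorrelation of any
observable certifies `τ_int ≥ (1 + ρ(1))/(2(1 − ρ(1)))` — e.g. `ρ(1) = 0.9` forces `τ_int ≥ 9.5`
whatever the higher lags do; negative `ρ(1)` (anti-correlated trajectories) lowers the floor below
`½`, which HMC at well-chosen trajectory lengths can exploit and an independence sampler cannot
(`FlowSamplerTauIntFloor`: `ρ(n) ≥ 0`).  NOT CLAIMED: `ρ(1) < 1` or summability for any run
(hypotheses; `Scoring/FreeFieldHMCAutocorrelation` has the free-field values); unbounded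
observables; momentum-refresh variants (partial refresh is not covered by `hmcOpOf`).
-/

namespace Summit.Ventures.LatticeQCDFlow.Exactness

open Real MeasureTheory Filter Finset
open Summit.Ventures.LatticeQCDFlow.Scoring

section HMC

variable {n : ℕ}

/-- The Gaussian momentum weight is positive. -/
theorem momentumWeight_pos (p : Fin (n + 1) → ℝ) : 0 < momentumWeight p := by
  unfold momentumWeight
  exact Real.exp_pos _

/-- The HMC integrand of a bounded measurable observable is measurable on phase space and bounded
by `B · e^{−½Σp²}`. -/
theorem hmcOpOf_integrand_bdd (J : Fin (n + 1) → Fin (n + 1) → ℝ) (lam : ℝ)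
    {Ψ : (Fin (n + 1) → ℝ) × (Fin (n + 1) → ℝ) → (Fin (n + 1) → ℝ) × (Fin (n + 1) → ℝ)}
    (hΨm : Measurable Ψ) {f : (Fin (n + 1) → ℝ) → ℝ} (hfm : Measurable f) {B : ℝ}
    (hfb : ∀ φ, |f φ| ≤ B) :
    Measurable (fun z : (Fin (n + 1) → ℝ) × (Fin (n + 1) → ℝ) =>
      (involAccept (phi4HmcEnergy J lam) Ψ z * f (Ψ z).1
        + (1 - involAccept (phi4HmcEnergy J lam) Ψ z) * f z.1) * momentumWeight z.2)
    ∧ ∀ z : (Fin (n + 1) → ℝ) × (Fin (n + 1) → ℝ),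
      |(involAccept (phi4HmcEnergy J lam) Ψ z * f (Ψ z).1
        + (1 - involAccept (phi4HmcEnergy J lam) Ψ z) * f z.1) * momentumWeight z.2|
      ≤ B * momentumWeight z.2 := by
  have hHm := measurable_phi4HmcEnergy J lam
  have ha := measurable_involAccept hHm hΨm
  refine ⟨((ha.mul (hfm.comp (measurable_fst.comp hΨm))).add
      ((measurable_const.sub ha).mul (hfm.comp measurable_fst))).mul
      (measurable_momentumWeight.comp measurable_snd), fun z => ?_⟩
  have ha0 := involAccept_nonneg (phi4HmcEnergy J lam) Ψ z
  have ha1 := involAccept_le_one (phi4HmcEnergy J lam) Ψ z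
  rw [abs_mul, abs_of_pos (momentumWeight_pos _)]
  refine mul_le_mul_of_nonneg_right ?_ (momentumWeight_pos _).le
  calc |involAccept (phi4HmcEnergy J lam) Ψ z * f (Ψ z).1
        + (1 - involAccept (phi4HmcEnergy J lam) Ψ z) * f z.1|
      ≤ |involAccept (phi4HmcEnergy J lam) Ψ z * f (Ψ z).1|
          + |(1 - involAccept (phi4HmcEnergy J lam) Ψ z) * f z.1| := abs_add_le _ _
    _ = involAccept (phi4HmcEnergy J lam) Ψ z * |f (Ψ z).1|
          + (1 - involAccept (phi4HmcEnergy J lam) Ψ z) * |f z.1| := by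
        rw [abs_mul, abs_mul, abs_of_nonneg ha0, abs_of_nonneg (sub_nonneg.2 ha1)]
    _ ≤ involAccept (phi4HmcEnergy J lam) Ψ z * B + (1 - involAccept (phi4HmcEnergy J lam) Ψ z) * B :=
        add_le_add (mul_le_mul_of_nonneg_left (hfb _) ha0)
          (mul_le_mul_of_nonneg_left (hfb _) (sub_nonneg.2 ha1))
    _ = B * 1 := by ring
    _ = B := mul_one B

/-- For each configuration the HMC integrand is integrable in the momenta. -/
theorem integrable_hmcOpOf_integrand (J : Fin (n + 1) → Fin (n + 1) → ℝ) (lam : ℝ)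
    {Ψ : (Fin (n + 1) → ℝ) × (Fin (n + 1) → ℝ) → (Fin (n + 1) → ℝ) × (Fin (n + 1) → ℝ)}
    (hΨm : Measurable Ψ) {f : (Fin (n + 1) → ℝ) → ℝ} (hfm : Measurable f) {B : ℝ}
    (hfb : ∀ φ, |f φ| ≤ B) (φ : Fin (n + 1) → ℝ) :
    Integrable (fun p : Fin (n + 1) → ℝ =>
      (involAccept (phi4HmcEnergy J lam) Ψ (φ, p) * f (Ψ (φ, p)).1
        + (1 - involAccept (phi4HmcEnergy J lam) Ψ (φ, p)) * f φ) * momentumWeight p) := by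
  obtain ⟨hGm, hGb⟩ := hmcOpOf_integrand_bdd J lam hΨm hfm hfb
  refine Integrable.mono' (integrable_momentumWeight.const_mul B)
    (hGm.comp (measurable_const.prodMk measurable_id)).aestronglyMeasurable
    (Eventually.of_forall fun p => ?_)
  rw [Real.norm_eq_abs]
  exact hGb (φ, p)

/-- **The HMC-type update maps bounded measurable observables to bounded measurable ones.** -/
theorem hmcOpOf_bdd (J : Fin (n + 1) → Fin (n + 1) → ℝ) (lam : ℝ)
    {Ψ : (Fin (n + 1) → ℝ) × (Fin (n + 1) → ℝ) → (Fin (n + 1) → ℝ) × (Fin (n + 1) → ℝ)}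
    (hΨm : Measurable Ψ) {f : (Fin (n + 1) → ℝ) → ℝ} (hfm : Measurable f) {B : ℝ}
    (hfb : ∀ φ, |f φ| ≤ B) :
    Measurable (hmcOpOf J lam Ψ f) ∧ ∀ φ, |hmcOpOf J lam Ψ f φ| ≤ B := by
  obtain ⟨hGm, hGb⟩ := hmcOpOf_integrand_bdd J lam hΨm hfm hfb
  have hZ := momentumZ_pos n
  refine ⟨?_, fun φ => ?_⟩
  · have h := (hGm.stronglyMeasurable.integral_prod_right'
      (ν := (volume : Measure (Fin (n + 1) → ℝ)))).measurable.div_const (momentumZ n)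
    exact h
  · unfold hmcOpOf
    rw [abs_div, abs_of_pos hZ, div_le_iff₀ hZ]
    have h := norm_integral_le_of_norm_le (integrable_momentumWeight.const_mul B)
      (Eventually.of_forall fun p => by rw [Real.norm_eq_abs]; exact hGb (φ, p))
    rw [integral_const_mul, Real.norm_eq_abs] at h
    exact h

/-- **The HMC-type update is linear** on bounded measurable observables. -/
theorem hmcOpOf_add_mul (J : Fin (n + 1) → Fin (n + 1) → ℝ) (lam : ℝ)
    {Ψ : (Fin (n + 1) → ℝ) × (Fin (n + 1) → ℝ) → (Fin (n + 1) → ℝ) × (Fin (n + 1) → ℝ)}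
    (hΨm : Measurable Ψ) {f h : (Fin (n + 1) → ℝ) → ℝ} (hfm : Measurable f) (hhm : Measurable h)
    {Bf Bh : ℝ} (hfb : ∀ φ, |f φ| ≤ Bf) (hhb : ∀ φ, |h φ| ≤ Bh) (c : ℝ) (φ : Fin (n + 1) → ℝ) :
    hmcOpOf J lam Ψ (fun s => f s + c * h s) φ = hmcOpOf J lam Ψ f φ + c * hmcOpOf J lam Ψ h φ := by
  unfold hmcOpOf
  have hIf := integrable_hmcOpOf_integrand J lam hΨm hfm hfb φ
  have hIh := integrable_hmcOpOf_integrand J lam hΨm hhm hhb φ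
  have e : ∀ p : Fin (n + 1) → ℝ,
      (involAccept (phi4HmcEnergy J lam) Ψ (φ, p) * (f (Ψ (φ, p)).1 + c * h (Ψ (φ, p)).1)
        + (1 - involAccept (phi4HmcEnergy J lam) Ψ (φ, p)) * (f φ + c * h φ)) * momentumWeight p
      = (involAccept (phi4HmcEnergy J lam) Ψ (φ, p) * f (Ψ (φ, p)).1
          + (1 - involAccept (phi4HmcEnergy J lam) Ψ (φ, p)) * f φ) * momentumWeight p
        + c * ((involAccept (phi4HmcEnergy J lam) Ψ (φ, p) * h (Ψ (φ, p)).1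
          + (1 - involAccept (phi4HmcEnergy J lam) Ψ (φ, p)) * h φ) * momentumWeight p) :=
    fun p => by ring
  simp_rw [e]
  rw [integral_add hIf (hIh.const_mul c), integral_const_mul]
  ring

/-- **Pointwise Jensen for the HMC-type update**: `(K_Ψ f)(φ)² ≤ (K_Ψ f²)(φ)` (Cauchy–Schwarz
against the Gaussian momentum law, then convexity of the square under accept/reject). -/
theorem hmcOpOf_sq_le (J : Fin (n + 1) → Fin (n + 1) → ℝ) (lam : ℝ)
    {Ψ : (Fin (n + 1) → ℝ) × (Fin (n + 1) → ℝ) → (Fin (n + 1) → ℝ) × (Fin (n + 1) → ℝ)}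
    (hΨm : Measurable Ψ) {f : (Fin (n + 1) → ℝ) → ℝ} (hfm : Measurable f) {B : ℝ}
    (hfb : ∀ φ, |f φ| ≤ B) (φ : Fin (n + 1) → ℝ) :
    hmcOpOf J lam Ψ f φ ^ 2 ≤ hmcOpOf J lam Ψ (fun s => f s ^ 2) φ := by
  have hZ := momentumZ_pos n
  have hHm := measurable_phi4HmcEnergy J lam
  have ha : Measurable fun p : Fin (n + 1) → ℝ => involAccept (phi4HmcEnergy J lam) Ψ (φ, p) :=
    (measurable_involAccept hHm hΨm).comp (measurable_const.prodMk measurable_id)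
  set u : (Fin (n + 1) → ℝ) → ℝ := fun p => involAccept (phi4HmcEnergy J lam) Ψ (φ, p) * f (Ψ (φ, p)).1
    + (1 - involAccept (phi4HmcEnergy J lam) Ψ (φ, p)) * f φ with hu
  have hum : Measurable u :=
    (ha.mul (hfm.comp (measurable_fst.comp (hΨm.comp (measurable_const.prodMk measurable_id))))).add
      ((measurable_const.sub ha).mul measurable_const)
  have hub : ∀ p, |u p| ≤ B := fun p => by
    have h := (hmcOpOf_integrand_bdd J lam hΨm hfm hfb).2 (φ, p)
    rw [abs_mul, abs_of_pos (momentumWeight_pos _)] at h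
    exact le_of_mul_le_mul_right h (momentumWeight_pos _)
  -- Cauchy–Schwarz against `e^{−½Σp²} dp`
  have hCS := sq_integral_le_integral_mul_integral (μ := (volume : Measure (Fin (n + 1) → ℝ)))
    (m := momentumWeight) (fun p => (momentumWeight_pos p).le) measurable_momentumWeight
    integrable_momentumWeight hum hub
  have e1 : hmcOpOf J lam Ψ f φ = (∫ p, momentumWeight p * u p) / momentumZ n := by
    unfold hmcOpOf
    congr 1
    refine integral_congr_ae (Eventually.of_forall fun p => ?_)
    simp only [hu]
    ring
  have hf2b : ∀ ψ, |f ψ ^ 2| ≤ B ^ 2 := fun ψ => by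
    rw [abs_pow]; exact pow_le_pow_left₀ (abs_nonneg _) (hfb ψ) 2
  have hI2 := integrable_hmcOpOf_integrand J lam hΨm (hfm.pow_const 2) hf2b φ
  have hI1 : Integrable (fun p => momentumWeight p * u p ^ 2) := by
    refine Integrable.mono' (integrable_momentumWeight.const_mul (B ^ 2))
      (measurable_momentumWeight.mul (hum.pow_const 2)).aestronglyMeasurable
      (Eventually.of_forall fun p => ?_)
    rw [Real.norm_eq_abs, abs_mul, abs_of_pos (momentumWeight_pos _), abs_pow, mul_comm]
    exact mul_le_mul_of_nonneg_right (pow_le_pow_left₀ (abs_nonneg _) (hub p) 2)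
      (momentumWeight_pos _).le
  have hstep : ∫ p, momentumWeight p * u p ^ 2
      ≤ ∫ p, (involAccept (phi4HmcEnergy J lam) Ψ (φ, p) * (fun s => f s ^ 2) (Ψ (φ, p)).1
          + (1 - involAccept (phi4HmcEnergy J lam) Ψ (φ, p)) * (fun s => f s ^ 2) φ)
          * momentumWeight p := by
    refine integral_mono hI1 hI2 fun p => ?_
    have ha0 := involAccept_nonneg (phi4HmcEnergy J lam) Ψ (φ, p)
    have ha1 := involAccept_le_one (phi4HmcEnergy J lam) Ψ (φ, p)
    dsimp only
    rw [mul_comm]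
    have hcx : (involAccept (phi4HmcEnergy J lam) Ψ (φ, p) * f (Ψ (φ, p)).1
        + (1 - involAccept (phi4HmcEnergy J lam) Ψ (φ, p)) * f φ) ^ 2
        ≤ involAccept (phi4HmcEnergy J lam) Ψ (φ, p) * f (Ψ (φ, p)).1 ^ 2
          + (1 - involAccept (phi4HmcEnergy J lam) Ψ (φ, p)) * f φ ^ 2 := by
      nlinarith [mul_nonneg (mul_nonneg ha0 (sub_nonneg.2 ha1)) (sq_nonneg (f (Ψ (φ, p)).1 - f φ))]
    exact mul_le_mul_of_nonneg_right hcx (momentumWeight_pos _).le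
  have hZeq : ∫ p : Fin (n + 1) → ℝ, momentumWeight p = momentumZ n := rfl
  rw [hZeq] at hCS
  calc hmcOpOf J lam Ψ f φ ^ 2 = (∫ p, momentumWeight p * u p) ^ 2 / momentumZ n ^ 2 := by
        rw [e1, div_pow]
    _ ≤ (momentumZ n * ∫ p, momentumWeight p * u p ^ 2) / momentumZ n ^ 2 :=
        div_le_div_of_nonneg_right hCS (sq_nonneg _)
    _ = (∫ p, momentumWeight p * u p ^ 2) / momentumZ n := by
        field_simp
    _ ≤ (∫ p, (involAccept (phi4HmcEnergy J lam) Ψ (φ, p) * (fun s => f s ^ 2) (Ψ (φ, p)).1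
          + (1 - involAccept (phi4HmcEnergy J lam) Ψ (φ, p)) * (fun s => f s ^ 2) φ)
          * momentumWeight p) / momentumZ n := div_le_div_of_nonneg_right hstep hZ.le
    _ = hmcOpOf J lam Ψ (fun s => f s ^ 2) φ := rfl

/-- **`L²(e^{−S})` CONTRACTION of the HMC-type update** for every measurable Lebesgue-preserving
involution `Ψ` and every coercive action: `∫ (K_Ψ f)² e^{−S} ≤ ∫ f² e^{−S}`. -/
theorem hmcOpOf_contraction {J : Fin (n + 1) → Fin (n + 1) → ℝ} {lam ε K : ℝ} (hε : 0 < ε)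
    (hS : ∀ φ : Fin (n + 1) → ℝ, ε * ∑ w, φ w ^ 2 - K ≤ latticePhi4Action J lam φ)
    {Ψ : (Fin (n + 1) → ℝ) × (Fin (n + 1) → ℝ) → (Fin (n + 1) → ℝ) × (Fin (n + 1) → ℝ)}
    (hΨm : Measurable Ψ) (hΨi : Function.Involutive Ψ)
    (hΨμ : MeasurePreserving Ψ ((volume : Measure (Fin (n + 1) → ℝ)).prod volume)
      ((volume : Measure (Fin (n + 1) → ℝ)).prod volume))
    {f : (Fin (n + 1) → ℝ) → ℝ} (hfm : Measurable f) {B : ℝ} (hfb : ∀ φ, |f φ| ≤ B) :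
    ∫ φ, hmcOpOf J lam Ψ f φ ^ 2 * gibbsWeight J lam φ ≤ ∫ φ, f φ ^ 2 * gibbsWeight J lam φ := by
  have hw_int : Integrable (gibbsWeight J lam) := integrable_gibbsWeight_of_coercive hε hS
  have hwm : Measurable (gibbsWeight J lam) := (continuous_gibbsWeight J lam).measurable
  have hf2m : Measurable fun s => f s ^ 2 := hfm.pow_const 2
  have hf2b : ∀ ψ, |f ψ ^ 2| ≤ B ^ 2 := fun ψ => by
    rw [abs_pow]; exact pow_le_pow_left₀ (abs_nonneg _) (hfb ψ) 2
  have hf2w : Integrable (fun φ => f φ ^ 2 * gibbsWeight J lam φ) :=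
    integrable_bdd_mul_weight hf2m hf2b hwm (fun φ => (gibbsWeight_pos J lam φ).le) hw_int
  have hex := hmc_exact_of_involutive hΨm hΨi hΨμ hf2m hf2w
  rw [← hex]
  obtain ⟨hK2m, hK2b⟩ := hmcOpOf_bdd J lam hΨm hf2m hf2b
  refine integral_mono_of_nonneg (Eventually.of_forall fun φ => mul_nonneg (sq_nonneg _)
      (gibbsWeight_pos J lam φ).le) ?_ (Eventually.of_forall fun φ => ?_)
  · exact integrable_bdd_mul_weight hK2m hK2b hwm (fun φ => (gibbsWeight_pos J lam φ).le) hw_int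
  · exact mul_le_mul_of_nonneg_right (hmcOpOf_sq_le J lam hΨm hfm hfb φ) (gibbsWeight_pos J lam φ).le

/-- **THE `τ_int` FLOOR FOR EVERY HMC-TYPE UPDATE OF LATTICE φ⁴** (any measurable
Lebesgue-preserving involution `Ψ` of phase space — qpq/pqp leapfrog, any symmetric integrator, any
step size and length).  Every `λ > 0`, every real `J`; `f` bounded measurable, `g = f − ⟨f⟩`,
`ρ(k) = ∫ g (K_Ψᵏ g) e^{−S} / ∫ g² e^{−S}`.  If the autocorrelation series is summable and
`ρ(1) < 1`, then `τ_int ≥ (1 + ρ(1))/(2(1 − ρ(1)))`. -/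
theorem hmc_tauInt_ge_of_involutive {lam : ℝ} (hlam : 0 < lam)
    (J : Fin (n + 1) → Fin (n + 1) → ℝ)
    {Ψ : (Fin (n + 1) → ℝ) × (Fin (n + 1) → ℝ) → (Fin (n + 1) → ℝ) × (Fin (n + 1) → ℝ)}
    (hΨm : Measurable Ψ) (hΨi : Function.Involutive Ψ)
    (hΨμ : MeasurePreserving Ψ ((volume : Measure (Fin (n + 1) → ℝ)).prod volume)
      ((volume : Measure (Fin (n + 1) → ℝ)).prod volume))
    {f : (Fin (n + 1) → ℝ) → ℝ} (hfm : Measurable f) {B : ℝ} (hfb : ∀ φ, |f φ| ≤ B)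
    (hs : Summable fun k => (∫ φ, (f φ - gibbsExpect J lam f)
        * ((hmcOpOf J lam Ψ)^[k + 1] (fun ψ => f ψ - gibbsExpect J lam f)) φ * gibbsWeight J lam φ)
        / ∫ φ, (f φ - gibbsExpect J lam f) ^ 2 * gibbsWeight J lam φ)
    (hρ1lt : (∫ φ, (f φ - gibbsExpect J lam f)
        * hmcOpOf J lam Ψ (fun ψ => f ψ - gibbsExpect J lam f) φ * gibbsWeight J lam φ)
        / (∫ φ, (f φ - gibbsExpect J lam f) ^ 2 * gibbsWeight J lam φ) < 1) :
    (1 + (∫ φ, (f φ - gibbsExpect J lam f)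
          * hmcOpOf J lam Ψ (fun ψ => f ψ - gibbsExpect J lam f) φ * gibbsWeight J lam φ)
          / ∫ φ, (f φ - gibbsExpect J lam f) ^ 2 * gibbsWeight J lam φ)
        / (2 * (1 - (∫ φ, (f φ - gibbsExpect J lam f)
          * hmcOpOf J lam Ψ (fun ψ => f ψ - gibbsExpect J lam f) φ * gibbsWeight J lam φ)
          / ∫ φ, (f φ - gibbsExpect J lam f) ^ 2 * gibbsWeight J lam φ))
      ≤ tauInt (fun k => (∫ φ, (f φ - gibbsExpect J lam f)
        * ((hmcOpOf J lam Ψ)^[k] (fun ψ => f ψ - gibbsExpect J lam f)) φ * gibbsWeight J lam φ)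
        / ∫ φ, (f φ - gibbsExpect J lam f) ^ 2 * gibbsWeight J lam φ) := by
  obtain ⟨hgm, hgb, -⟩ := centred_observable hlam J hfm hfb
  have hco := latticePhi4Action_coercive hlam J
  exact reversible_tauInt_ge (μ := volume) (K := hmcOpOf J lam Ψ) (w := gibbsWeight J lam)
    (fun φ => gibbsWeight_pos J lam φ) (continuous_gibbsWeight J lam).measurable
    (integrable_gibbsWeight hlam J)
    (fun f B hfm hfb => hmcOpOf_bdd J lam hΨm hfm hfb)
    (fun f h Bf Bh c hfm hhm hfb hhb φ => hmcOpOf_add_mul J lam hΨm hfm hhm hfb hhb c φ)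
    (fun f h Bf Bh hfm hhm hfb hhb => hmc_reversible_of_involutive one_pos hco hΨm hΨi hΨμ
      hfm hhm hfb hhb)
    (fun f B hfm hfb => hmcOpOf_contraction one_pos hco hΨm hΨi hΨμ hfm hfb)
    hgm hgb hs hρ1lt

/-- **THE `τ_int` FLOOR FOR ROW 2's HMC** (qpq leapfrog, every step size `δ`, every trajectory
length `N`; every `λ > 0`, every real `J`): summable autocorrelations with `ρ(1) < 1` give
`τ_int ≥ (1 + ρ(1))/(2(1 − ρ(1)))`. -/
theorem hmc_tauInt_ge {lam : ℝ} (hlam : 0 < lam) (J : Fin (n + 1) → Fin (n + 1) → ℝ) (δ : ℝ)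
    (N : ℕ) {f : (Fin (n + 1) → ℝ) → ℝ} (hfm : Measurable f) {B : ℝ} (hfb : ∀ φ, |f φ| ≤ B)
    (hs : Summable fun k => (∫ φ, (f φ - gibbsExpect J lam f)
        * ((hmcOpPhi4 J lam δ N)^[k + 1] (fun ψ => f ψ - gibbsExpect J lam f)) φ * gibbsWeight J lam φ)
        / ∫ φ, (f φ - gibbsExpect J lam f) ^ 2 * gibbsWeight J lam φ)
    (hρ1lt : (∫ φ, (f φ - gibbsExpect J lam f)
        * hmcOpPhi4 J lam δ N (fun ψ => f ψ - gibbsExpect J lam f) φ * gibbsWeight J lam φ)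
        / (∫ φ, (f φ - gibbsExpect J lam f) ^ 2 * gibbsWeight J lam φ) < 1) :
    (1 + (∫ φ, (f φ - gibbsExpect J lam f)
          * hmcOpPhi4 J lam δ N (fun ψ => f ψ - gibbsExpect J lam f) φ * gibbsWeight J lam φ)
          / ∫ φ, (f φ - gibbsExpect J lam f) ^ 2 * gibbsWeight J lam φ)
        / (2 * (1 - (∫ φ, (f φ - gibbsExpect J lam f)
          * hmcOpPhi4 J lam δ N (fun ψ => f ψ - gibbsExpect J lam f) φ * gibbsWeight J lam φ)
          / ∫ φ, (f φ - gibbsExpect J lam f) ^ 2 * gibbsWeight J lam φ))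
      ≤ tauInt (fun k => (∫ φ, (f φ - gibbsExpect J lam f)
        * ((hmcOpPhi4 J lam δ N)^[k] (fun ψ => f ψ - gibbsExpect J lam f)) φ * gibbsWeight J lam φ)
        / ∫ φ, (f φ - gibbsExpect J lam f) ^ 2 * gibbsWeight J lam φ) :=
  hmc_tauInt_ge_of_involutive hlam J (measurable_hmcProposal J lam δ N)
    (hmcProposal_involutive J lam δ N) (measurePreserving_hmcProposal J lam δ N) hfm hfb hs hρ1lt

end HMC

end Summit.Ventures.LatticeQCDFlow.Exactness
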